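import Literature.NumberTheory.Automorphic.CompactGroupMultiplicitySpace
import HarnessLib

/-!
# The multiplicity space `Hom_H(τ, ρ)` as an inner product space (Hilbert–Schmidt form)

Topic `Literature/NumberTheory/Automorphic` (`HilbertRepSpectrum` vocabulary).  Definitions with bodies
(`ContRepresentation.HomSpace` and its structure maps) and theorems; no named fact.

For a representation `ρ` of `H` on an inner product space `X` and a representation `τ` of `H` on a finite-dimensional
inner product space `F`, the space of intertwiners `Hom_H(τ, ρ)` (`Schur.intertwiners τ ρ`, a subspace of `F →L X`
carrying the operator norm) is given here the **Hilbert–Schmidt inner product**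
`⟪S, T⟫ = Σᵢ ⟪S eᵢ, T eᵢ⟫` over the standard orthonormal basis `(eᵢ)` of `F` — Deitmar–Echterhoff, *Principles of
Harmonic Analysis* §7.3, Lemma 7.3.1 (PDF p. 197): on `Hom_K(V_τ, V_π)` «`⟨α, β⟩ = ⟨α(v₀), β(v₀)⟩` … defines an inner
product» (for irreducible unitary `τ` and unitary `π` all the `⟨α(v), β(v)⟩`, `‖v‖ = 1`, agree by Schur's lemma, so the
Hilbert–Schmidt form is `dim τ` times theirs; the Hilbert–Schmidt form is positive definite for every `τ`, which is why it
is used here).  With it `Hom_H(τ, ρ)` becomes an inner product space, complete when `X` is (it embeds isometrically onto a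
closed subspace of `X^{dim τ}`), so that the tree's unitary vocabulary (`IsUnitary`, `isotypicComponent`, `multiplicity`)
applies to the `G`-action on the multiplicity space of a representation of `G × H` (Bröcker–tom Dieck II (4.14), proof:
«`G` acts on `f ∈ Hom_H(W_j, U)` by `(gf)(w) = g·f(w)`»).

* `ContRepresentation.HomSpace τ ρ` — the type `Hom_H(τ, ρ)` (a synonym of `Schur.intertwiners τ ρ` that does NOT inherit
  the operator norm); `HomSpace.toCLM`, `HomSpace.mk`, `HomSpace.ext`, `HomSpace.toCLMₗ`;
* `HomSpace.instInner`, `instNormedAddCommGroup`, `instInnerProductSpace` — the Hilbert–Schmidt inner product space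
  structure; `HomSpace.inner_def`, `HomSpace.norm_sq_eq`, `HomSpace.norm_apply_le`, `HomSpace.norm_toCLM_le`;
* `HomSpace.toPiLp` — the isometric embedding `S ↦ (S eᵢ)ᵢ` into `PiLp 2 (fun _ => X)`; `isClosed_range_toPiLp`;
  `HomSpace.instCompleteSpace` — **`Hom_H(τ, ρ)` is a Hilbert space when `X` is**;
* `ContRepresentation.homRep U τ : ContRepresentation ℂ G (HomSpace τ (U|_H))` — **the representation
  `(g·T) = U(g, 1) ∘ T` of `G` on the multiplicity space** of a representation `U` of `G × H`; `homRep_apply_toCLM`;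
  `isUnitary_homRep` (unitary when `U` is), `isStronglyContinuous_homRep` (strongly continuous when `U|_G` is),
  `toCLM_homRep_apply_apply` (`(g·T)(τ(h) f) = U(g, h)(T f)`).

## References
* A. Deitmar, S. Echterhoff, *Principles of Harmonic Analysis*, 2nd ed. (2014), §7.3 Lemma 7.3.1, PDF p. 197
  [DeitmarEchterhoff2014].
* T. Bröcker, T. tom Dieck, *Representations of Compact Lie Groups*, GTM 98 (1985), II Prop (4.14) proof, PDF p. 80
  [BrockerTomDieck1985].

## Provenance
Lane `lit-hodgefound` (HOME `run/shared/lean/pub/lit-hodgefound/`), prover seat `lit-hodgefound-p05` generation 7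
(Layer 0: Howe's `Θ(τ') = Hom_{K'}(τ', ω)` as a unitary representation, beneath C2-08 / C2-10).
-/

noncomputable section

open ContinuousLinearMap Filter Topology
open Literature.RepresentationTheory.CompactGroups Literature.NumberTheory.Automorphic
open scoped InnerProductSpace ComplexConjugate

namespace ContRepresentation

section HomSpace

variable {H : Type*} [Group H]
variable {X : Type*} [NormedAddCommGroup X] [InnerProductSpace ℂ X]
variable {F : Type*} [NormedAddCommGroup F] [InnerProductSpace ℂ F]

/-- **The multiplicity space `Hom_H(τ, ρ)`** as a bare type: a synonym of the subspace `Schur.intertwiners τ ρ` of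
`H`-intertwiners `V_τ → X` which does not inherit the operator norm (it is normed below by the Hilbert–Schmidt form of
Deitmar–Echterhoff Lemma 7.3.1). [cite: DeitmarEchterhoff2014, Lemma 7.3.1] -/
def HomSpace (τ : ContRepresentation ℂ H F) (ρ : ContRepresentation ℂ H X) : Type _ := Schur.intertwiners τ ρ

namespace HomSpace

variable {τ : ContRepresentation ℂ H F} {ρ : ContRepresentation ℂ H X}

/-- The additive group structure of `Hom_H(τ, ρ)` (inherited from the subspace of intertwiners). [cite: DeitmarEchterhoff2014, Lemma 7.3.1] -/
instance instAddCommGroup : AddCommGroup (HomSpace τ ρ) := inferInstanceAs (AddCommGroup (Schur.intertwiners τ ρ))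

/-- The `ℂ`-vector space structure of `Hom_H(τ, ρ)` (inherited from the subspace of intertwiners). [cite: DeitmarEchterhoff2014, Lemma 7.3.1] -/
instance instModule : Module ℂ (HomSpace τ ρ) := inferInstanceAs (Module ℂ (Schur.intertwiners τ ρ))

/-- The underlying operator `V_τ → X` of an element of the multiplicity space. [cite: DeitmarEchterhoff2014, Lemma 7.3.1] -/
def toCLM (S : HomSpace τ ρ) : F →L[ℂ] X := ((show Schur.intertwiners τ ρ from S) : F →L[ℂ] X)

/-- An intertwiner seen in the multiplicity space. [cite: DeitmarEchterhoff2014, Lemma 7.3.1] -/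
def mk (T : F →L[ℂ] X) (hT : T ∈ Schur.intertwiners τ ρ) : HomSpace τ ρ := (⟨T, hT⟩ : Schur.intertwiners τ ρ)

/-- `(mk T hT).toCLM = T`. [cite: DeitmarEchterhoff2014, Lemma 7.3.1] -/
@[simp]
theorem toCLM_mk (T : F →L[ℂ] X) (hT : T ∈ Schur.intertwiners τ ρ) : (mk T hT : HomSpace τ ρ).toCLM = T := rfl

/-- The underlying operator is an `H`-intertwiner. [cite: DeitmarEchterhoff2014, Lemma 7.3.1] -/
theorem toCLM_mem (S : HomSpace τ ρ) : S.toCLM ∈ Schur.intertwiners τ ρ := (show Schur.intertwiners τ ρ from S).2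

/-- The intertwining relation `ρ(h) ∘ S = S ∘ τ(h)`. [cite: DeitmarEchterhoff2014, Lemma 7.3.1] -/
theorem comp_toCLM (S : HomSpace τ ρ) (h : H) : ρ h ∘L S.toCLM = S.toCLM ∘L τ h := S.toCLM_mem h

/-- The intertwining relation on vectors: `ρ(h) (S f) = S (τ(h) f)`. [cite: DeitmarEchterhoff2014, Lemma 7.3.1] -/
theorem apply_toCLM_apply (S : HomSpace τ ρ) (h : H) (f : F) : ρ h (S.toCLM f) = S.toCLM (τ h f) :=
  congrArg (fun T : F →L[ℂ] X => T f) (S.comp_toCLM h)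

/-- Two elements with the same operator are equal. [cite: DeitmarEchterhoff2014, Lemma 7.3.1] -/
@[ext]
theorem ext {S T : HomSpace τ ρ} (h : S.toCLM = T.toCLM) : S = T := Subtype.ext h

/-- `toCLM` is injective. [cite: DeitmarEchterhoff2014, Lemma 7.3.1] -/
theorem toCLM_injective : Function.Injective (toCLM : HomSpace τ ρ → F →L[ℂ] X) := fun _ _ h => ext h

/-- `toCLM` of `0`. [cite: DeitmarEchterhoff2014, Lemma 7.3.1] -/
@[simp] theorem toCLM_zero : (0 : HomSpace τ ρ).toCLM = 0 := rfl

/-- `toCLM` is additive. [cite: DeitmarEchterhoff2014, Lemma 7.3.1] -/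
@[simp] theorem toCLM_add (S T : HomSpace τ ρ) : (S + T).toCLM = S.toCLM + T.toCLM := rfl

/-- `toCLM` is homogeneous. [cite: DeitmarEchterhoff2014, Lemma 7.3.1] -/
@[simp] theorem toCLM_smul (c : ℂ) (S : HomSpace τ ρ) : (c • S).toCLM = c • S.toCLM := rfl

/-- `toCLM` of a negative. [cite: DeitmarEchterhoff2014, Lemma 7.3.1] -/
@[simp] theorem toCLM_neg (S : HomSpace τ ρ) : (-S).toCLM = -S.toCLM := rfl

/-- `toCLM` of a difference. [cite: DeitmarEchterhoff2014, Lemma 7.3.1] -/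
@[simp] theorem toCLM_sub (S T : HomSpace τ ρ) : (S - T).toCLM = S.toCLM - T.toCLM := rfl

/-- `toCLM` as a linear map. [cite: DeitmarEchterhoff2014, Lemma 7.3.1] -/
def toCLMₗ : HomSpace τ ρ →ₗ[ℂ] (F →L[ℂ] X) where
  toFun := toCLM
  map_add' := toCLM_add
  map_smul' := toCLM_smul

/-- Unfolding `toCLMₗ`. [cite: DeitmarEchterhoff2014, Lemma 7.3.1] -/
@[simp] theorem toCLMₗ_apply (S : HomSpace τ ρ) : toCLMₗ S = S.toCLM := rfl

/-! #### The Hilbert–Schmidt inner product -/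

variable [FiniteDimensional ℂ F]

/-- **The Hilbert–Schmidt inner product `⟪S, T⟫ = Σᵢ ⟪S eᵢ, T eᵢ⟫`** over the standard orthonormal basis of `V_τ`
(Deitmar–Echterhoff Lemma 7.3.1: `⟨α, β⟩ = ⟨α(v₀), β(v₀)⟩`, summed over an orthonormal basis). [cite: DeitmarEchterhoff2014, Lemma 7.3.1] -/
instance instInner : Inner ℂ (HomSpace τ ρ) :=
  ⟨fun S T => ∑ i, ⟪S.toCLM (stdOrthonormalBasis ℂ F i), T.toCLM (stdOrthonormalBasis ℂ F i)⟫_ℂ⟩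

/-- Unfolding the inner product. [cite: DeitmarEchterhoff2014, Lemma 7.3.1] -/
theorem inner_def (S T : HomSpace τ ρ) :
    ⟪S, T⟫_ℂ = ∑ i, ⟪S.toCLM (stdOrthonormalBasis ℂ F i), T.toCLM (stdOrthonormalBasis ℂ F i)⟫_ℂ :=
  rfl

/-- An element of `Hom_H(τ, ρ)` whose operator vanishes on the standard orthonormal basis of `V_τ` is zero (an operator is
determined by its values on a basis). [cite: DeitmarEchterhoff2014, Lemma 7.3.1] -/
theorem toCLM_eq_zero_of_forall (S : HomSpace τ ρ) (h : ∀ i, S.toCLM (stdOrthonormalBasis ℂ F i) = 0) : S = 0 := by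
  apply ext
  rw [toCLM_zero]
  apply ContinuousLinearMap.coe_injective
  refine (stdOrthonormalBasis ℂ F).toBasis.ext fun i => ?_
  rw [OrthonormalBasis.coe_toBasis, ContinuousLinearMap.coe_coe, h i]
  rfl

/-- **`Hom_H(τ, ρ)` is a normed group for the Hilbert–Schmidt norm `‖S‖² = Σᵢ ‖S eᵢ‖²`.**
[cite: DeitmarEchterhoff2014, Lemma 7.3.1] -/
instance instNormedAddCommGroup : NormedAddCommGroup (HomSpace τ ρ) :=
  letI : InnerProductSpace.Core ℂ (HomSpace τ ρ) :=
  { conj_inner_symm := fun S T => by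
      change conj (∑ i, ⟪T.toCLM _, S.toCLM _⟫_ℂ) = ∑ i, ⟪S.toCLM _, T.toCLM _⟫_ℂ
      rw [map_sum]
      exact Finset.sum_congr rfl fun i _ => inner_conj_symm _ _
    re_inner_nonneg := fun S => by
      change 0 ≤ RCLike.re (∑ i, ⟪S.toCLM _, S.toCLM _⟫_ℂ)
      rw [map_sum]
      exact Finset.sum_nonneg fun i _ => inner_self_nonneg
    add_left := fun S T R => by
      change ∑ i, ⟪(S + T).toCLM _, R.toCLM _⟫_ℂ = ∑ i, ⟪S.toCLM _, R.toCLM _⟫_ℂ + ∑ i, ⟪T.toCLM _, R.toCLM _⟫_ℂ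
      rw [← Finset.sum_add_distrib]
      exact Finset.sum_congr rfl fun i _ => by rw [toCLM_add, _root_.add_apply, inner_add_left]
    smul_left := fun S T c => by
      change ∑ i, ⟪(c • S).toCLM _, T.toCLM _⟫_ℂ = conj c * ∑ i, ⟪S.toCLM _, T.toCLM _⟫_ℂ
      rw [Finset.mul_sum]
      exact Finset.sum_congr rfl fun i _ => by rw [toCLM_smul, _root_.smul_apply, inner_smul_left]
    definite := fun S hS => by
      apply toCLM_eq_zero_of_forall
      intro i
      have h : ∑ j, (‖S.toCLM (stdOrthonormalBasis ℂ F j)‖ ^ 2 : ℝ) = 0 := by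
        have h' := congrArg RCLike.re hS
        change RCLike.re (∑ j, ⟪S.toCLM _, S.toCLM _⟫_ℂ) = RCLike.re (0 : ℂ) at h'
        rw [map_sum, map_zero] at h'
        simpa only [inner_self_eq_norm_sq] using h'
      have hi := (Finset.sum_eq_zero_iff_of_nonneg fun j _ => sq_nonneg _).mp h i (Finset.mem_univ i)
      exact norm_eq_zero.mp (pow_eq_zero_iff two_ne_zero |>.mp hi) }
  this.toNormedAddCommGroup

/-- **`Hom_H(τ, ρ)` is an inner product space** (Hilbert–Schmidt form). [cite: DeitmarEchterhoff2014, Lemma 7.3.1] -/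
instance instInnerProductSpace : InnerProductSpace ℂ (HomSpace τ ρ) := .ofCore _

/-- **`‖S‖² = Σᵢ ‖S eᵢ‖²`.** [cite: DeitmarEchterhoff2014, Lemma 7.3.1] -/
theorem norm_sq_eq (S : HomSpace τ ρ) : ‖S‖ ^ 2 = ∑ i, ‖S.toCLM (stdOrthonormalBasis ℂ F i)‖ ^ 2 := by
  rw [@norm_sq_eq_re_inner ℂ, inner_def, map_sum]
  exact Finset.sum_congr rfl fun i _ => inner_self_eq_norm_sq _

/-- Each `‖S eᵢ‖` is bounded by the Hilbert–Schmidt norm. [cite: DeitmarEchterhoff2014, Lemma 7.3.1] -/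
theorem norm_apply_le (S : HomSpace τ ρ) (i : Fin (Module.finrank ℂ F)) :
    ‖S.toCLM (stdOrthonormalBasis ℂ F i)‖ ≤ ‖S‖ := by
  refine le_of_sq_le_sq ?_ (norm_nonneg _)
  rw [norm_sq_eq]
  exact Finset.single_le_sum (f := fun j => ‖S.toCLM (stdOrthonormalBasis ℂ F j)‖ ^ 2) (fun j _ => sq_nonneg _)
    (Finset.mem_univ i)

/-! #### `Hom_H(τ, ρ)` is a Hilbert space: the isometric embedding `S ↦ (S eᵢ)ᵢ` into `X^{dim τ}` -/

/-- **The isometric embedding `S ↦ (S eᵢ)ᵢ` of `Hom_H(τ, ρ)` into `X^{dim τ}`** (with the `ℓ²`-norm, Mathlib `PiLp 2`).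
[cite: DeitmarEchterhoff2014, Lemma 7.3.1] -/
def toPiLp : HomSpace τ ρ →ₗᵢ[ℂ] PiLp 2 (fun _ : Fin (Module.finrank ℂ F) => X) where
  toLinearMap :=
  { toFun := fun S => WithLp.toLp 2 fun i => S.toCLM (stdOrthonormalBasis ℂ F i)
    map_add' := fun S T => by
      refine PiLp.ext fun i => ?_
      simp only [PiLp.add_apply, toCLM_add, _root_.add_apply]
    map_smul' := fun c S => by
      refine PiLp.ext fun i => ?_
      simp only [PiLp.smul_apply, toCLM_smul, _root_.smul_apply, RingHom.id_apply] }
  norm_map' := fun S => by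
    have h1 : ‖WithLp.toLp 2 (fun i => S.toCLM (stdOrthonormalBasis ℂ F i))‖ ^ 2 =
        ∑ i, ‖S.toCLM (stdOrthonormalBasis ℂ F i)‖ ^ 2 := by
      rw [PiLp.norm_sq_eq_of_L2]
    exact (sq_eq_sq₀ (norm_nonneg _) (norm_nonneg _)).mp (h1.trans (norm_sq_eq S).symm)

/-- Components of the embedding. [cite: DeitmarEchterhoff2014, Lemma 7.3.1] -/
@[simp]
theorem toPiLp_apply (S : HomSpace τ ρ) (i : Fin (Module.finrank ℂ F)) :
    toPiLp S i = S.toCLM (stdOrthonormalBasis ℂ F i) := rfl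

/-- **The image of `Hom_H(τ, ρ)` in `X^{dim τ}` is closed**: it is cut out by the closed conditions
`ρ(h) ∘ T_x = T_x ∘ τ(h)`, where `T_x = Σᵢ ⟪eᵢ, ·⟫ xᵢ` is the operator with values `xᵢ` on the basis.
[cite: DeitmarEchterhoff2014, Lemma 7.3.1] -/
theorem isClosed_range_toPiLp :
    IsClosed (Set.range (toPiLp : HomSpace τ ρ → PiLp 2 (fun _ : Fin (Module.finrank ℂ F) => X))) := by
  classical
  set b := stdOrthonormalBasis ℂ F with hb
  -- the operator with prescribed values on the basis
  set T : PiLp 2 (fun _ : Fin (Module.finrank ℂ F) => X) → (F →L[ℂ] X) :=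
    fun x => ∑ i, ContinuousLinearMap.smulRightL ℂ F X (innerSL ℂ (b i)) (x i) with hT
  have hTcont : Continuous T :=
    continuous_finsetSum _ fun i _ =>
      (ContinuousLinearMap.smulRightL ℂ F X (innerSL ℂ (b i))).continuous.comp
        ((continuous_apply i).comp (PiLp.continuous_ofLp 2 _))
  have hTb : ∀ (x : PiLp 2 (fun _ : Fin (Module.finrank ℂ F) => X)) (j : Fin (Module.finrank ℂ F)),
      T x (b j) = x j := by
    intro x j
    have horth : ∀ i, ⟪b i, b j⟫_ℂ = if i = j then (1 : ℂ) else 0 := fun i => orthonormal_iff_ite.mp b.orthonormal i j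
    have h1 : T x (b j) = ∑ i, ⟪b i, b j⟫_ℂ • x i := by
      rw [hT, _root_.sum_apply]
      exact Finset.sum_congr rfl fun i _ => by
        rw [ContinuousLinearMap.smulRightL_apply_apply, ContinuousLinearMap.smulRight_apply, innerSL_apply_apply]
    rw [h1]
    simp_rw [horth, ite_smul, one_smul, zero_smul, Finset.sum_ite_eq' Finset.univ j, if_pos (Finset.mem_univ j)]
  have hTS : ∀ S : HomSpace τ ρ, T (toPiLp S) = S.toCLM := by
    intro S
    apply ContinuousLinearMap.coe_injective
    refine b.toBasis.ext fun j => ?_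
    rw [OrthonormalBasis.coe_toBasis, ContinuousLinearMap.coe_coe, ContinuousLinearMap.coe_coe, hTb, toPiLp_apply]
  have hrange : Set.range (toPiLp : HomSpace τ ρ → PiLp 2 (fun _ : Fin (Module.finrank ℂ F) => X)) =
      {x | ∀ h : H, ρ h ∘L T x = T x ∘L τ h} := by
    ext x
    constructor
    · rintro ⟨S, rfl⟩ h
      rw [hTS]
      exact S.comp_toCLM h
    · intro hx
      refine ⟨mk (T x) hx, PiLp.ext fun i => ?_⟩
      rw [toPiLp_apply, toCLM_mk, hTb]
  rw [hrange, Set.setOf_forall]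
  exact isClosed_iInter fun h =>
    isClosed_eq ((ContinuousLinearMap.compL ℂ F X X (ρ h)).continuous.comp hTcont)
      (((ContinuousLinearMap.compL ℂ F F X).flip (τ h)).continuous.comp hTcont)

/-- **`Hom_H(τ, ρ)` is complete when `X` is** (it is isometric to a closed subspace of `X^{dim τ}`).
[cite: DeitmarEchterhoff2014, Lemma 7.3.1] -/
instance instCompleteSpace [CompleteSpace X] : CompleteSpace (HomSpace τ ρ) :=
  (completeSpace_iff_isComplete_range
      (toPiLp : HomSpace τ ρ →ₗᵢ[ℂ] PiLp 2 (fun _ : Fin (Module.finrank ℂ F) => X)).isometry.isUniformInducing).mpr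
    isClosed_range_toPiLp.isComplete

/-- Continuity into `Hom_H(τ, ρ)` can be tested componentwise (`eᵢ`-wise). [cite: DeitmarEchterhoff2014, Lemma 7.3.1] -/
theorem continuous_iff {Y : Type*} [TopologicalSpace Y] {f : Y → HomSpace τ ρ} :
    Continuous f ↔ ∀ i : Fin (Module.finrank ℂ F), Continuous fun y => (f y).toCLM (stdOrthonormalBasis ℂ F i) := by
  rw [(toPiLp : HomSpace τ ρ →ₗᵢ[ℂ] _).isometry.isUniformInducing.isInducing.continuous_iff]
  constructor
  · intro h i
    exact (continuous_apply i).comp ((PiLp.continuous_ofLp 2 _).comp h)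
  · intro h
    exact (PiLp.continuous_toLp 2 _).comp (continuous_pi fun i => h i)

end HomSpace

end HomSpace

/-! ### The representation of `G` on the multiplicity space of a representation of `G × H` -/

section Product

variable {G H : Type*} [Group G] [Group H]
variable {X : Type*} [NormedAddCommGroup X] [InnerProductSpace ℂ X]
variable {F : Type*} [NormedAddCommGroup F] [InnerProductSpace ℂ F] [FiniteDimensional ℂ F]

/-- `‖A ∘ S‖ ≤ ‖A‖ ‖S‖` for the Hilbert–Schmidt norm. [cite: DeitmarEchterhoff2014, Lemma 7.3.1] -/
theorem HomSpace.norm_mk_comp_le {τ : ContRepresentation ℂ H F} {ρ : ContRepresentation ℂ H X} (A : X →L[ℂ] X)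
    (S : HomSpace τ ρ) (hAS : A ∘L S.toCLM ∈ Schur.intertwiners τ ρ) :
    ‖(HomSpace.mk (A ∘L S.toCLM) hAS : HomSpace τ ρ)‖ ≤ ‖A‖ * ‖S‖ := by
  refine le_of_sq_le_sq ?_ (mul_nonneg (norm_nonneg _) (norm_nonneg _))
  rw [mul_pow, HomSpace.norm_sq_eq, HomSpace.norm_sq_eq, Finset.mul_sum]
  refine Finset.sum_le_sum fun i _ => ?_
  rw [HomSpace.toCLM_mk, ContinuousLinearMap.comp_apply, ← mul_pow]
  exact pow_le_pow_left₀ (norm_nonneg _) (A.le_opNorm _) 2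

/-- **The multiplicity space `Θ(τ) = Hom_H(τ, U|_H)` of a representation `U` of `G × H` as a representation of `G`**
on the Hilbert–Schmidt inner product space `HomSpace τ (U|_H)`: `(g·T) = U(g, 1) ∘ T` (Bröcker–tom Dieck II (4.14), proof:
«`G` acts on `f ∈ Hom_H(W_j, U)` by `(gf)(w) = g·f(w)`»; bounded by `‖U(g, 1)‖`). [cite: BrockerTomDieck1985, II Prop (4.14)]
[cite: DeitmarEchterhoff2014, Lemma 7.3.1] -/
def homRep (U : ContRepresentation ℂ (G × H) X) (τ : ContRepresentation ℂ H F) :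
    ContRepresentation ℂ G (HomSpace τ (U.restrict (MonoidHom.inr G H))) where
  toMonoidHom :=
  { toFun := fun g => LinearMap.mkContinuous
      { toFun := fun S => HomSpace.mk (U.restrict (MonoidHom.inl G H) g ∘L S.toCLM)
          (comp_restrict_inl_mem_intertwiners_restrict_inr S.toCLM_mem g)
        map_add' := fun S T => HomSpace.ext (by
          simp only [HomSpace.toCLM_mk, HomSpace.toCLM_add, ContinuousLinearMap.comp_add])
        map_smul' := fun c S => HomSpace.ext (by
          simp only [HomSpace.toCLM_mk, HomSpace.toCLM_smul, ContinuousLinearMap.comp_smul, RingHom.id_apply]) }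
      ‖U.restrict (MonoidHom.inl G H) g‖ fun S => HomSpace.norm_mk_comp_le _ S _
    map_one' := by
      refine ContinuousLinearMap.ext fun S => HomSpace.ext ?_
      simp only [LinearMap.mkContinuous_apply, LinearMap.coe_mk, AddHom.coe_mk, HomSpace.toCLM_mk, map_one,
        ContinuousLinearMap.one_def, ContinuousLinearMap.id_comp]
      rfl
    map_mul' := fun g g' => by
      refine ContinuousLinearMap.ext fun S => HomSpace.ext ?_
      simp only [LinearMap.mkContinuous_apply, LinearMap.coe_mk, AddHom.coe_mk, HomSpace.toCLM_mk, map_mul,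
        ContinuousLinearMap.mul_def, ContinuousLinearMap.comp_assoc, ContinuousLinearMap.comp_apply] }

variable {U : ContRepresentation ℂ (G × H) X} {τ : ContRepresentation ℂ H F}

variable (U τ) in
/-- Unfolding: `(g·T) = U(g, 1) ∘ T` as operators. [cite: BrockerTomDieck1985, II Prop (4.14)] -/
@[simp]
theorem toCLM_homRep_apply (g : G) (S : HomSpace τ (U.restrict (MonoidHom.inr G H))) :
    (U.homRep τ g S).toCLM = U.restrict (MonoidHom.inl G H) g ∘L S.toCLM :=
  rfl

/-- **`G × H`-equivariance of evaluation**: `(g·T)(τ(h) f) = U(g, h)(T f)`. [cite: BrockerTomDieck1985, II Prop (4.14)] -/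
theorem toCLM_homRep_apply_apply (g : G) (h : H) (S : HomSpace τ (U.restrict (MonoidHom.inr G H))) (f : F) :
    (U.homRep τ g S).toCLM (τ h f) = U (g, h) (S.toCLM f) :=
  (apply_eval_eq_comp_restrict_inl_apply S.toCLM_mem g h f).symm

/-- **`Θ(τ)` is unitary when `U` is** (each `U(g, 1)` is a unitary: `Σᵢ ⟪U(g,1) S eᵢ, U(g,1) T eᵢ⟫ = Σᵢ ⟪S eᵢ, T eᵢ⟫`).
[cite: DeitmarEchterhoff2014, Lemma 7.3.1] -/
theorem isUnitary_homRep [CompleteSpace X] (hU : U.IsUnitary) : (U.homRep τ).IsUnitary := by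
  refine ContRepresentation.isUnitary_iff_inner_map_map.mpr fun g S T => ?_
  rw [HomSpace.inner_def, HomSpace.inner_def]
  refine Finset.sum_congr rfl fun i _ => ?_
  rw [toCLM_homRep_apply, toCLM_homRep_apply, ContinuousLinearMap.comp_apply, ContinuousLinearMap.comp_apply,
    ContRepresentation.restrict_apply, hU.inner_map_map]

/-- **`Θ(τ)` is strongly continuous when `U|_G` is** (continuity is tested on the basis vectors `eᵢ`).
[cite: BrockerTomDieck1985, II Prop (4.14)] -/
theorem isStronglyContinuous_homRep [TopologicalSpace G] (hUc : (U.restrict (MonoidHom.inl G H)).IsStronglyContinuous) :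
    (U.homRep τ).IsStronglyContinuous := fun S =>
  HomSpace.continuous_iff.mpr fun i => hUc (S.toCLM (stdOrthonormalBasis ℂ F i))

end Product

end ContRepresentation

end
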